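import Summits.CriticalPhenomena.SAWScalingLimit.Theses.SAWWeldingIdentification

/-!
# Strategist s3 sketch — typed strengthening for the census (crux stmt-CriticalPhenomena-1372, bet route `SAWWeldingIdentification`)

`NoFjordAllScales` (S⁺, welding-natural): a polynomial no-fjord bound at ALL scales simultaneously, eventually in `δ` —
the lattice shadow of "both banks of the walk are uniformly Hölder domains" (Smith–Stegenga 1987: Hölder ⟺ the quasi-hyperbolic
distance grows at most logarithmically in `1/dist(·,∂)`, which forbids fjords of width `w` and depth `≫ w log(1/w)`), i.e. the
engine the route's crux `RemovableLimit` names ("uniform Hölder/John estimates for the two banks") AND a strengthening of the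
tightness crux.  `noReturn_of_noFjordAllScales` places it above the fixed-scale no-return strengthening `NoReturnTight` of
strategist b1 (`HasReturn`), which itself sits above the crux (b1 census §Strengthen S_A, pigeonhole, not formalised here).
Nothing here is asserted; STRATEGY-CENSUS.md §Strengthen says why it buys nothing for THIS step.
-/

noncomputable section

open MeasureTheory Filter Topology Set Metric
open scoped ENNReal NNReal unitInterval
open Literature.Probability.RandomPlanarGeometry Literature.Probability.LatticeModels

namespace Summit.CriticalPhenomena.SAWScalingLimit.Cruxes.EventualTight.StrategistS3

/-- A parametrised curve has a `(w, ℓ)`-FJORD: three times `s < t < u` with the two ends `w`-close and the middle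
`ℓ`-far from the first end (= b1's `HasReturn c w ℓ`). -/
def HasFjord (c : unitInterval → ℂ) (w ℓ : ℝ) : Prop :=
  ∃ s t u : unitInterval, s < t ∧ t < u ∧ dist (c s) (c u) ≤ w ∧ ℓ ≤ dist (c s) (c t)

/-- **S⁺ `NoFjordAllScales`** (uniform Hölder banks, lattice form): for every Dobrushin domain and endpoint approximation
there is an exponent `λ ∈ (0, 1)` such that for every `θ > 0` some `M, w₀, δ₀` make the event "the mesh-`δ` polyline has a
`(w, M·w^λ)`-fjord at SOME scale `w ∈ [δ, w₀]`" carry mass `≤ θ` for all `δ ∈ (0, δ₀]`. -/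
def NoFjordAllScales : Prop :=
  ∀ (D : DobrushinDomain) (a b : ℝ → Site 2), SAW.IsEndpointApprox D a b →
    ∃ lam : ℝ, 0 < lam ∧ lam < 1 ∧ ∀ θ : ℝ, 0 < θ → ∃ (M w₀ δ₀ : ℝ), 0 < M ∧ 0 < w₀ ∧ 0 < δ₀ ∧
      ∀ δ ∈ Set.Ioc (0 : ℝ) δ₀, SAW.law D.carrier δ (a δ) (b δ)
        {γ | ∃ w : ℝ, δ ≤ w ∧ w ≤ w₀ ∧
          HasFjord (fun s => (⟨γ.walk.toCurve (meshPoint δ)⟩ : Curve ℂ) s) w (M * w ^ lam)} ≤ ENNReal.ofReal θ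

/-- **b1's fixed-scale strengthening `NoReturnTight`** (restated with `HasFjord = HasReturn`): for every `ℓ > 0` and `θ > 0`
some `ε > 0` makes `(ε, ℓ)`-returns carry mass `≤ θ` for all small `δ`. -/
def NoReturnTight : Prop :=
  ∀ (D : DobrushinDomain) (a b : ℝ → Site 2), SAW.IsEndpointApprox D a b →
    ∀ ℓ : ℝ, 0 < ℓ → ∀ θ : ℝ, 0 < θ → ∃ (ε δ₀ : ℝ), 0 < ε ∧ 0 < δ₀ ∧
      ∀ δ ∈ Set.Ioc (0 : ℝ) δ₀, SAW.law D.carrier δ (a δ) (b δ)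
        {γ | HasFjord (fun s => (⟨γ.walk.toCurve (meshPoint δ)⟩ : Curve ℂ) s) ε ℓ} ≤ ENNReal.ofReal θ

/-- `NoFjordAllScales → NoReturnTight`: at the single scale `w = ε` with `M ε^λ ≤ ℓ`, an `(ε, ℓ)`-return IS an
`(ε, M ε^λ)`-fjord. [folklore] -/
theorem noReturn_of_noFjordAllScales (h : NoFjordAllScales) : NoReturnTight := by
  intro D a b hab ℓ hℓ θ hθ
  obtain ⟨lam, hlam0, _hlam1, hθall⟩ := h D a b hab
  obtain ⟨M, w₀, δ₀, hM, hw₀, hδ₀, hbound⟩ := hθall θ hθ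
  set ε : ℝ := min w₀ ((ℓ / M) ^ (1 / lam)) with hε
  have hεpos : 0 < ε := lt_min hw₀ (Real.rpow_pos_of_pos (div_pos hℓ hM) _)
  have hεw : ε ≤ w₀ := min_le_left _ _
  have hεℓ : M * ε ^ lam ≤ ℓ := by
    have h1 : ε ^ lam ≤ ((ℓ / M) ^ (1 / lam)) ^ lam :=
      Real.rpow_le_rpow hεpos.le (min_le_right _ _) hlam0.le
    have h2 : ((ℓ / M) ^ (1 / lam)) ^ lam = ℓ / M := by
      rw [← Real.rpow_mul (div_pos hℓ hM).le, one_div, inv_mul_cancel₀ hlam0.ne', Real.rpow_one]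
    rw [h2] at h1
    calc M * ε ^ lam ≤ M * (ℓ / M) := mul_le_mul_of_nonneg_left h1 hM.le
      _ = ℓ := by field_simp
  refine ⟨ε, min ε δ₀, hεpos, lt_min hεpos hδ₀, fun δ hδ => ?_⟩
  have hδ' : δ ∈ Set.Ioc (0 : ℝ) δ₀ := ⟨hδ.1, hδ.2.trans (min_le_right _ _)⟩
  refine le_trans (measure_mono ?_) (hbound δ hδ')
  intro γ hγ
  obtain ⟨s, t, u, hst, htu, hsu, hfar⟩ := hγ
  exact ⟨ε, hδ.2.trans (min_le_left _ _), hεw, s, t, u, hst, htu, hsu, hεℓ.trans hfar⟩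

#print axioms noReturn_of_noFjordAllScales

end Summit.CriticalPhenomena.SAWScalingLimit.Cruxes.EventualTight.StrategistS3

end
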